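import Mathlib
import HarnessLib
import Summits.HubbardSuperconductivity.HubbardSuperconductivity.Theorems.KLProgrammeH10TwoPointLimitSectorMultiplierBound
import Summits.HubbardSuperconductivity.HubbardSuperconductivity.Theorems.KLProgrammeH10TwoPointLimitSectorMultiplierFat
import Summits.HubbardSuperconductivity.HubbardSuperconductivity.Theorems.KLProgrammeH10TwoPointLimitFramePerturbation

/-!
# Route `KLProgramme` — engine support, route (L2): `hrow′/hcol′` of the single-scale step at scale `n ≥ 1` — the row and column sums of
# the overlap kernel `E′(klAnisoFamily … n)·S(bgmFatMultiplier … (n−1))` are `≤ 81·C_B·M/β` and `≤ 162·C_B·M/β` on every admissible frame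

Cell `gate-hubbard-kl`, seat p4 (C5a lead), g7.  Composition of the lineage's route (L2): the thin × fat reduction
(`overlap_rowSum/colSum_klAniso_bgmFat_le`, `…SectorMultiplierFat`) fed with the uniform thin × thin bound
(`charSum_klAnisoPair_le_uniform`, `…SectorMultiplierBound`) at the neighbouring scales `(n, n−1)`:

* `overlap_sums_klAniso_bgmFat_le` — keyed by the frame's `C²` size `A` and the symbol-layer data (`d`, `B_a`, the window band bounds),
  with the constant `C_B` of `…SectorMultiplierBound` (named parameters with defining equations): for `1 ≤ n`, `Λ_n β < π(2M−3)`,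
  `βe₀ ≤ M`, `(4π/L)(2ⁿ + ½) ≤ z`, `2π·16ⁿ ≤ L`, `π/(4β) ≤ Λ_n`: `hrow′ ≤ 81·C_B·M/β`, `hcol′ ≤ 162·C_B·M/β` — so with `ε_x = β/(2M)` the
  products `ε_x·hrow′`, `ε_x·hcol′` entering BGM (2.77) are the n-UNIFORM numbers `81C_B/2`, `81C_B`.

These are exactly the hypotheses `hrow′/hcol′` of `hubbardSectorKernelNorm_effAction_le_of_sectorNorm` for the step `n−1 → n` of the
engine (`F = klAnisoFamily … (n−1)`, `F̃ = bgmFatMultiplier … (n−1)`, `F′ = klAnisoFamily … n`).  Everything is proved; no definitions, no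
named facts. [cite: BenfattoGiulianiMastropietro2006, §2.7 (2.66), (2.71)–(2.71a), §2.8 (2.77)]
-/

noncomputable section

namespace Summit.HubbardSuperconductivity.HubbardSuperconductivity.Theorems.TorusFourierL2

set_option linter.dupNamespace false -- summit = problem name (single-conjunct summit), D-0017

open Set Finset Literature.MathematicalPhysics.QuantumLattice Literature.MathematicalPhysics.QuantumLattice.BandSectorCounting
open Literature.MathematicalPhysics.QuantumLattice.FermiRG Literature.Probability.LatticeModels Literature.Analysis.SpecialFunctions
open Summit.HubbardSuperconductivity.HubbardSuperconductivity.Theorems.DispersionFlow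
open Summit.HubbardSuperconductivity.HubbardSuperconductivity.Theorems.KLRegimeSplit
open Summit.HubbardSuperconductivity.HubbardSuperconductivity.Theorems.KLProgrammeLegKernels
open Summit.HubbardSuperconductivity.HubbardSuperconductivity.Theorems.PerturbedFermiCurve
open scoped Real

section FrameKeyed

variable {L M : ℕ} [NeZero L] [NeZero M] {a b : ℝ} (B : BandBounds a b) {K : TrigPolyC4v} {A : ℝ}
  (hA : ∀ p : Momentum, ∀ j ≤ 2, ‖iteratedFDeriv ℝ j (frameShift K) p‖ ≤ A) (hADt : 2 * A < B.Dtmin)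
  {μ e₀ z β : ℝ} (he : 0 < e₀) (hz : 0 < z) (hz1 : z ≤ 1) (hgap : e₀ + A + z ^ 2 < -μ) (h3 : e₀ + A - μ ≤ 3)
  (hlo : a ≤ μ - A - e₀) (hhi : μ + A + e₀ ≤ b) (hβ : 0 < β) (hρA : 4 * A < 2 * B.rhomin)
  {d : ℝ} (hd : 0 < d) (hd1 : ∀ u, |deriv (bgmCutoffSq e₀) u| ≤ d) (hd2 : ∀ u, |iteratedDeriv 2 (bgmCutoffSq e₀) u| ≤ d)
  {Ba : ℝ} (hB0 : 0 < Ba)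
  (hB : ∀ (i : ℕ), i ≤ 2 → ∀ (n : ℕ) (ω : ℤ) (θ₀ : ℝ) (q w : Fin 2 → ℝ) (t : ℝ) {r₀ : ℝ}, 0 < r₀ →
    r₀ ≤ ‖momToComplex (q + t • w)‖ → |sectorRelAngle θ₀ (q + t • w)| < π →
    ‖iteratedDeriv i (fun t : ℝ => sectorWeightCirc n ω (polarAngle (q + t • w))) t‖ ≤
      (2 : ℕ).factorial * Ba * ((1 + (sectorWidth n)⁻¹ * (2 : ℕ).factorial) * ‖momToComplex w‖ / r₀) ^ i)
  {cG c1 ρb Y κ κX cN1 cN2 : ℝ}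
  (hcG : cG = 4 * (d * e₀ ^ 4 * 1 + 2 * (d * e₀ ^ 2) * (d * e₀ ^ 2) + 1 * (d * e₀ ^ 4)) + 2 * (d * e₀ ^ 2 * 1 + 1 * (d * e₀ ^ 2)))
  (hc1 : c1 = d * e₀ ^ 2 * 1 + 1 * (d * e₀ ^ 2))
  (hρb : ρb = (e₀ + 3 * π / 2 * B.smax * B.Dtmin) / (B.Dtmin - 2 * A))
  (hY : Y = (4 + 2 * A) + (4 + 4 * A) * (2 * ρb + 5))
  (hκ : κ = cG * Y ^ 2 + 2 * c1 * (4 + 4 * A) * (9 / 4) * e₀ + 8 * c1 * Ba * Y * 12 * e₀ + 2 * Ba * 72 * e₀ ^ 2 +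
    8 * Ba ^ 2 * 36 * e₀ ^ 2)
  (hκX : κX = 4 * (3 * Real.sqrt 2 * π * Real.sqrt κ + 2 * e₀) ^ 2 / e₀ +
    96 / (π * e₀ ^ 2) * ((π * Real.sqrt κ / 2) * (π * Real.sqrt κ / 2 + e₀) ^ 2))
  (hcN1 : cN1 = Real.sqrt 2 * (e₀ + (4 + 4 * A) * ρb ^ 2) / ((2 * B.rhomin - 4 * A) * π) + 2)
  (hcN2 : cN2 = 2 * Real.sqrt 2 * ρb / π + 2)

include B hA hADt he hz hz1 hgap h3 hlo hhi hβ hρA hd hd1 hd2 hB0 hB hcG hc1 hρb hY hκ hκX hcN1 hcN2 in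
/-- **`hrow′/hcol′` of the step at scale `n ≥ 1` on an admissible frame.**  For the NEW thin family `F′ = klAnisoFamily … n` and the FAT
family `F̃ = bgmFatMultiplier … (n−1)` of the old scale, every row sum of `‖(E′S)(Y′, Y)‖` is `≤ 81·C_B·M/β` and every column sum is
`≤ 162·C_B·M/β`, `C_B = √(2048(π√c_G+1)κ_X·(160/π)c_{N,1}c_{N,2}/e₀)` the constant of `charSum_klAnisoPair_le_uniform` — uniform in
the scale, the frame (given its `C²` size `A`), `β`, `L`, `M`. [cite: BenfattoGiulianiMastropietro2006, §2.7 (2.71a)] -/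
theorem overlap_sums_klAniso_bgmFat_le {n : ℕ} (hn : 1 ≤ n) (hM : klScale e₀ n * β < π * (2 * M - 3)) (hMβ : β * e₀ ≤ M)
    (hLz : 2 * |2 * π / (L : ℝ)| * ((2 : ℝ) ^ n + 1 / 2) ≤ z) (hL16 : 2 * π * (16 : ℝ) ^ n ≤ L) (hΛβ : π / (4 * β) ≤ klScale e₀ n) :
    (∀ Y' : SpaceTimeIdx L M × SectorLeg (sectorCount n),
      ∑ Y, ‖(sectorAnalysisMatrix L M β (klAnisoFamily L M β μ K e₀ n) *
        sectorSubMatrix L M β (bgmFatMultiplier L M e₀ β (nambuXiCT L μ K) (n - 1))) Y' Y‖ ≤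
        81 * (Real.sqrt (2048 * (π * Real.sqrt cG + 1) * κX * (160 / π * (cN1 * cN2)) / e₀) * M / β)) ∧
    (∀ Y : SpaceTimeIdx L M × SectorLeg (sectorCount (n - 1)),
      ∑ Y', ‖(sectorAnalysisMatrix L M β (klAnisoFamily L M β μ K e₀ n) *
        sectorSubMatrix L M β (bgmFatMultiplier L M e₀ β (nambuXiCT L μ K) (n - 1))) Y' Y‖ ≤
        162 * (Real.sqrt (2048 * (π * Real.sqrt cG + 1) * κX * (160 / π * (cN1 * cN2)) / e₀) * M / β)) := by
  have hL : (0 : ℝ) < L := Nat.cast_pos.2 (Nat.pos_of_ne_zero (NeZero.ne L))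
  set S : ℝ := Real.sqrt (2048 * (π * Real.sqrt cG + 1) * κX * (160 / π * (cN1 * cN2)) / e₀) with hS
  have hS0 : 0 ≤ S := Real.sqrt_nonneg _
  have hT0 : 0 ≤ S * M * (L : ℝ) ^ 2 := by positivity
  -- the uniform thin × thin bound at the scales `(n, n − 1)`
  have hT : ∀ (ω₁ : Fin (sectorCount n)) (a' : Fin (sectorCount (n - 1))), ∑ zz : TorusSite 1 (2 * M) × TorusSite 2 L,
      ‖∑ q : TorusSite 1 (2 * M) × TorusSite 2 L, (torusChar q.1 zz.1 * torusChar q.2 zz.2) •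
        (klAnisoFamily L M β μ K e₀ n ω₁ (⟨(q.1 0).val, ZMod.val_lt (q.1 0)⟩, q.2) *
          klAnisoFamily L M β μ K e₀ (n - 1) a' (⟨(q.1 0).val, ZMod.val_lt (q.1 0)⟩, q.2))‖ ≤ S * M * (L : ℝ) ^ 2 :=
    fun ω₁ a' => charSum_klAnisoPair_le_uniform B hA hADt he hz hz1 hgap h3 hlo hhi hβ hρA (Nat.sub_le n 1) ω₁ a' hd hd1 hd2
      (Z := fun p : Fin 2 → ℝ => gnCutoff ((π + z) ^ 2 / π ^ 2) ((π + z) ^ 2) (p 0 ^ 2) *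
        gnCutoff ((π + z) ^ 2 / π ^ 2) ((π + z) ^ 2) (p 1 ^ 2) *
        ((radialCutoffC (1 / 2) (momToComplex p) * sectorWeightCirc n ((ω₁ : ℕ) : ℤ) (polarAngle p)) *
          (radialCutoffC (1 / 2) (momToComplex p) * sectorWeightCirc (n - 1) ((a' : ℕ) : ℤ) (polarAngle p))))
      (fun _ => rfl)
      (Φ := fun kp : ℝ × (Fin 2 → ℝ) => ((bgmCutoffSq e₀ ((16 : ℝ) ^ n * (kp.1 ^ 2 + frameLevel μ K (WithLp.toLp 2 kp.2) ^ 2)) *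
        bgmCutoffSq e₀ ((16 : ℝ) ^ (n - 1) * (kp.1 ^ 2 + frameLevel μ K (WithLp.toLp 2 kp.2) ^ 2)) *
        (gnCutoff ((π + z) ^ 2 / π ^ 2) ((π + z) ^ 2) (kp.2 0 ^ 2) * gnCutoff ((π + z) ^ 2 / π ^ 2) ((π + z) ^ 2) (kp.2 1 ^ 2) *
          ((radialCutoffC (1 / 2) (momToComplex kp.2) * sectorWeightCirc n ((ω₁ : ℕ) : ℤ) (polarAngle kp.2)) *
            (radialCutoffC (1 / 2) (momToComplex kp.2) * sectorWeightCirc (n - 1) ((a' : ℕ) : ℤ) (polarAngle kp.2)))) : ℝ) : ℂ))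
      (fun _ _ => rfl)
      (Gs := fun q : TorusSite 1 (2 * M) × TorusSite 2 L =>
        klAnisoFamily L M β μ K e₀ n ω₁ (⟨(q.1 0).val, ZMod.val_lt (q.1 0)⟩, q.2) *
          klAnisoFamily L M β μ K e₀ (n - 1) a' (⟨(q.1 0).val, ZMod.val_lt (q.1 0)⟩, q.2))
      (fun _ => rfl) hB0 hB hcG hc1 hρb hY hκ hκX hcN1 hcN2 (by omega) hM hMβ hLz hL16 hΛβ
  have hn' : n - 1 + 1 ≤ n := by omega
  have e81 : ((27 : ℕ) : ℝ) * (3 * (S * M * (L : ℝ) ^ 2) / (β * (L : ℝ) ^ 2)) = 81 * (S * M / β) := by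
    field_simp
    ring
  have e162 : ((27 * 2 ^ (n - (n - 1)) : ℕ) : ℝ) * (3 * (S * M * (L : ℝ) ^ 2) / (β * (L : ℝ) ^ 2)) = 162 * (S * M / β) := by
    have : n - (n - 1) = 1 := by omega
    rw [this]
    push_cast
    field_simp
    ring
  refine ⟨fun Y' => ?_, fun Y => ?_⟩
  · have h := overlap_rowSum_klAniso_bgmFat_le (M := M) he hβ μ K hn' hT0 hT Y'
    rwa [e81] at h
  · have h := overlap_colSum_klAniso_bgmFat_le (M := M) he hβ μ K hn' hT0 hT Y
    rwa [e162] at h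

end FrameKeyed

end Summit.HubbardSuperconductivity.HubbardSuperconductivity.Theorems.TorusFourierL2

end
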